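import Mathlib.Algebra.Category.Grp.FilteredColimits
import Literature.Algebra.Homology.CechFiniteFamily
import Literature.Algebra.Homology.CechUniverseLift
import Literature.AlgebraicGeometry.Motives.EtaleToProetLocalGlobal
import Literature.AlgebraicGeometry.Motives.EtaleToProetPresentedCover
import Literature.AlgebraicGeometry.Motives.EtaleToProetUniverseLift
import HarnessLib

/-!
# Bhatt–Scholze Cor. 5.1.6: presented covers, their Čech complexes, and the comparison from the
# cofinality of presented covers (Thm. 2.3.4) alone

The tree reduces the pro-étale/étale comparison `nonempty_addEquiv_sheafH_etaleToProetPullback`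
(Bhatt–Scholze Cor. 5.1.6) — with input (B) proved in `EtaleToProetUniverseLift.lean` — to (A): the
étale acyclicity of `ν*(ulift I)` on `X_proét` for injective étale sheaves `I` (`etaleAcyclic`,
`EtaleToProetLeray.lean`), i.e. the affine content of the printed proof: "it suffices to prove
`Hᵖ(U, ν*I) = 0` for `U ∈ X_proét^aff` … By [SGA4, V.4.3] it suffices that `Ȟᵖ(U, ν*I) = 0` … By
Theorem 2.3.4, a cofinal collection of covers of `U` in `X_proét` is obtained by taking cofiltered
limits of affine étale covers obtained via base change from some `U_i` … `RΓ` of `ν*I` on them is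
a filtered colimit of étale Čech complexes of `I`, acyclic as each `I|_{U_i}` is injective and
filtered colimits are exact." This file formalises everything in that argument except
Theorem 2.3.4 itself, which enters as the explicit cofinality hypothesis `hT'` of the final theorems:

* (`PresentedCover 𝔭`, from `EtaleToProetPresentedCover.lean`: finitely many
  `V_a = lim_k V_{a,k}` with affine `V_{a,k} ∈ X_ét` over `U_{p k}` along an initial `p : K → ι`,
  the `V_a → W` jointly generating a pro-étale covering sieve);
* `PresentedCover.prodPresentation` — **the fibre products `V_{a₀} ×_W ⋯ ×_W V_{aₙ}` are pro-étale
  affines**, presented by `k ↦ V_{a₀,k} ×_{U_{pk}} ⋯ ×_{U_{pk}} V_{aₙ,k}` (limits commute with limits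
  in `Sch/X`; Remark 4.2.3), `isProetAffine_cechWidePullback`;
* `PresentedCover.sections_exact`, `PresentedCover.cechCochainComplex_exactAt_succ` — **the Čech
  complex of `ν*(ulift I)` for a presented cover is exact in positive degrees**: by Lemma 5.1.1
  (`nonempty_isColimit_sectionsCocone_etaleToProetPullback_holds`) its sections over the fibre
  products are filtered colimits of the `(ulift I)(V_{a₀,k} ×_{U_{pk}} ⋯)`, compatibly with the
  Čech differentials of the section models (`CechFiniteFamily.lean`); levelwise these are Čech
  complexes in `X_ét` of the Čech-acyclic `ulift I` (Milne III 2.4, `CechUniverseLift.lean`), and a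
  cocycle upstairs comes from a common level, dies at a further common level and is a coboundary
  there;
* `etaleToProetPullbackULift_mem_etaleAcyclic_of_cofinal` — **(A) from Cartan's criterion**
  (`CartanCriterion.lean`) on `X_proét` with `B` the pro-étale affines and `Cov` the presented
  covers, modulo the cofinality `hT'`; the `Ext`-vanishing class is a lifting class
  (`isLiftingClass_extVanishing`) containing the affine étale objects;
* `nonempty_addEquiv_sheafH_etaleToProetPullback_of_cofinal`,
  `ellAdicCohomology_limOneSequence_of_cofinal` — **Cor. 5.1.6 and Prop. 5.6.2 from `hT'` alone.**

## References

* B. Bhatt, P. Scholze, *The pro-étale topology for schemes*, Astérisque 369 (2015)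
  (arXiv:1309.1198, held): Def. 4.2.1, Lemma 4.2.2 / Remark 4.2.3 (connected limits of pro-étale
  affines), Lemma 5.1.1, Cor. 5.1.6 and its proof (p. 30), Thm. 2.3.4, Prop. 5.6.2. [BhattScholze2015]
* J. S. Milne, *Étale cohomology* (2025 reissue): III Lemma 2.4, III Prop. 2.12. [Milne2025]
* The Stacks Project, Tag 03F9. [StacksProject]

## Design notes

* Only theorems and real definitions (D-0026): `hT'` — every pro-étale covering sieve of a pro-étale
  affine contains the arrow of a presented cover — is an explicit hypothesis, the residual printed
  content (Thm. 2.3.4: weakly étale algebras are ind-étale up to faithfully flat ind-étale covers,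
  plus the descent of étale covers to a finite stage), never a named fact.
* The covering property of `(V_a → W)_a` is a field of `PresentedCover` (supplied by whoever proves
  `hT'`); the levelwise maps `V_{a,k} → U_{pk}` need not be covers, since injective étale sheaves
  are Čech-acyclic for every family (Milne III 2.4).
* Universes: `X : Scheme.{u}`; pro-étale families indexed by `ULift.{u+1} (Fin r)`, coefficients
  `Ab.{u+1}`; the levelwise étale families are indexed by `Fin r` and reindexed by
  `preZeroHypercoverULift` for the coefficient lift `uliftEtSheaf`. `family` and `levelObj` are
  reducible.
* Typing discipline: the levelwise fibre products `levelObj` are reducible, and all identities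
  between composites of `X`-scheme morphisms are proved for morphisms with their types spelled out
  (`section Clean`), so that no rewriting happens under cone legs.
* Mathlib searches: `Scheme.isAffine_of_isLimit` (limits of affine schemes are affine),
  `Over.forget` preserves connected limits,
  `Functor.Initial.isLimitWhiskerEquiv`, `AddCommGrpCat.FilteredColimits.colimitCoconeIsColimit`,
  `Concrete.isColimit_exists_of_rep_eq`, `Types.jointly_surjective_of_isColimit`; no presentations
  of fibre products of pro-objects in Mathlib or the tree. Nothing restated.
-/

universe uS

open CategoryTheory Limits Opposite AlgebraicGeometry

noncomputable section

namespace Literature.AlgebraicGeometry.Motives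

variable {X : Scheme.{uS}}

section PresentedCover

variable {W : X.ProEt} {𝔭 : ProetAffinePresentation X W}

namespace PresentedCover

variable (c : PresentedCover 𝔭)

/-! #### The levelwise fibre products `V_{a₀,k} ×_{U_{pk}} ⋯ ×_{U_{pk}} V_{aₙ,k}` -/

variable (n : ℕ) (kk : Fin (n + 1) → ULift.{uS + 1} (Fin c.r))

/-- `V_{a₀,k} ×_{U_{p k}} ⋯ ×_{U_{p k}} V_{aₙ,k}` for an index map `a : Fin (n+1) → Fin r`, in `X_ét`
(reducible, so that the wide-pullback API applies to it verbatim). [folklore] -/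
abbrev levelObj (k : c.K) : X.Etale :=
  widePullback (𝔭.diagram.obj (c.p.obj k)) (fun a : Fin (n + 1) => (c.diagram (kk a).down).obj k)
    (fun a => c.τ' (kk a).down k)

/-- The levelwise fibre products are affine. [folklore] -/
instance isAffine_levelObj_left (k : c.K) : IsAffine (c.levelObj n kk k).left := by
  haveI := 𝔭.isAffine (c.p.obj k)
  haveI : ∀ a : Fin (n + 1), IsAffine ((c.diagram (kk a).down).obj k).left := fun a => c.isAffine _ k
  exact isAffine_widePullback_left _ _ _

/-- The transition maps of the levelwise fibre products. [folklore] -/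
def levelMap {k k' : c.K} (g : k ⟶ k') : c.levelObj n kk k ⟶ c.levelObj n kk k' :=
  WidePullback.lift (WidePullback.base _ ≫ 𝔭.diagram.map (c.p.map g))
    (fun a => WidePullback.π _ a ≫ (c.diagram (kk a).down).map g) (fun a => by
      rw [Category.assoc, c.τ'_naturality _ g, ← Category.assoc, WidePullback.π_arrow])

/-- `levelMap` followed by a projection. [folklore] -/
@[reassoc]
lemma levelMap_π {k k' : c.K} (g : k ⟶ k') (a : Fin (n + 1)) :
    c.levelMap n kk g ≫ WidePullback.π (fun a => c.τ' (kk a).down k') a =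
      WidePullback.π _ a ≫ (c.diagram (kk a).down).map g :=
  WidePullback.lift_π _ _ _ _ _

/-- `levelMap` followed by the base map. [folklore] -/
@[reassoc]
lemma levelMap_base {k k' : c.K} (g : k ⟶ k') :
    c.levelMap n kk g ≫ WidePullback.base (fun a => c.τ' (kk a).down k') =
      WidePullback.base _ ≫ 𝔭.diagram.map (c.p.map g) :=
  WidePullback.lift_base _ _ _ _

/-- The diagram `k ↦ V_{a₀,k} ×_{U_{p k}} ⋯ ×_{U_{p k}} V_{aₙ,k}`. [folklore] -/
def levelDiagram : c.K ⥤ X.Etale where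
  obj := c.levelObj n kk
  map := c.levelMap n kk
  map_id k := by
    apply WidePullback.hom_ext
    · intro a
      rw [levelMap_π, CategoryTheory.Functor.map_id, Category.comp_id, Category.id_comp]
    · rw [levelMap_base, CategoryTheory.Functor.map_id, CategoryTheory.Functor.map_id,
        Category.comp_id, Category.id_comp]
  map_comp g g' := by
    apply WidePullback.hom_ext
    · intro a
      rw [levelMap_π, Category.assoc, levelMap_π, levelMap_π_assoc, CategoryTheory.Functor.map_comp]
    · rw [levelMap_base, Category.assoc, levelMap_base, levelMap_base_assoc,
        CategoryTheory.Functor.map_comp, CategoryTheory.Functor.map_comp]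

/-- `levelDiagram` on objects (by `rfl`). [folklore] -/
lemma levelDiagram_obj (k : c.K) : (c.levelDiagram n kk).obj k = c.levelObj n kk k := rfl

/-- `levelDiagram` on morphisms (by `rfl`). [folklore] -/
lemma levelDiagram_map {k k' : c.K} (g : k ⟶ k') : (c.levelDiagram n kk).map g = c.levelMap n kk g := rfl

/-! #### The fibre products `V_{a₀} ×_W ⋯ ×_W V_{aₙ}` and their presentation -/

/-- `V_{a₀} ×_W ⋯ ×_W V_{aₙ}` in `X_proét` — the wide pullback `cechWidePullback c.family.f a` used
by Cartan's criterion for the family `(V_a → W)_a` (by `rfl`). [folklore] -/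
abbrev prod : X.ProEt := widePullback W (fun a : Fin (n + 1) => c.V (kk a).down) (fun a => c.hom (kk a).down)

/-- `ν(V_{a₀,k} ×_{U_{pk}} ⋯)` is a wide pullback in `X_proét` (`ν` preserves finite limits). [folklore] -/
def isLimitLevelObj (k : c.K) :
    IsLimit ((etaleToProet X).mapCone (limit.cone (WidePullbackShape.wideCospan
      (𝔭.diagram.obj (c.p.obj k)) (fun a : Fin (n + 1) => (c.diagram (kk a).down).obj k)
      (fun a => c.τ' (kk a).down k)))) :=
  isLimitOfPreserves (etaleToProet X) (limit.isLimit _)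

/-- The cone over `ν(V_{a,k} → U_{pk} ← ⋯)` with apex `V_{a₀} ×_W ⋯ ×_W V_{aₙ}`. [folklore] -/
def levelConeAux (k : c.K) :
    Cone (WidePullbackShape.wideCospan (𝔭.diagram.obj (c.p.obj k))
      (fun a : Fin (n + 1) => (c.diagram (kk a).down).obj k) (fun a => c.τ' (kk a).down k) ⋙ etaleToProet X) :=
  WidePullbackShape.mkCone (WidePullback.base (fun a => c.hom (kk a).down) ≫ 𝔭.proj (c.p.obj k))
    (fun a => WidePullback.π (fun a => c.hom (kk a).down) a ≫ c.ρ' (kk a).down k) (fun a => by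
      change (WidePullback.π (fun a => c.hom (kk a).down) a ≫ c.ρ' (kk a).down k) ≫
          (etaleToProet X).map (c.τ' (kk a).down k) =
        WidePullback.base (fun a => c.hom (kk a).down) ≫ 𝔭.proj (c.p.obj k)
      rw [Category.assoc, c.ρ'_τ' _ k]
      exact WidePullback.π_arrow_assoc (fun a => c.hom (kk a).down) a (𝔭.proj (c.p.obj k)))

/-- The projection `V_{a₀} ×_W ⋯ ×_W V_{aₙ} → ν(V_{a₀,k} ×_{U_{pk}} ⋯ ×_{U_{pk}} V_{aₙ,k})`. [folklore] -/
def levelπ (k : c.K) : c.prod n kk ⟶ (etaleToProet X).obj (c.levelObj n kk k) :=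
  (c.isLimitLevelObj n kk k).lift (c.levelConeAux n kk k)

/-- `levelπ` followed by a projection. [folklore] -/
@[reassoc]
lemma levelπ_map_π (k : c.K) (a : Fin (n + 1)) :
    c.levelπ n kk k ≫ (etaleToProet X).map (WidePullback.π (fun a => c.τ' (kk a).down k) a) =
      WidePullback.π (fun a => c.hom (kk a).down) a ≫ c.ρ' (kk a).down k :=
  (c.isLimitLevelObj n kk k).fac (c.levelConeAux n kk k) (some a)

/-- `levelπ` followed by the base map. [folklore] -/
@[reassoc]
lemma levelπ_map_base (k : c.K) :
    c.levelπ n kk k ≫ (etaleToProet X).map (WidePullback.base (fun a => c.τ' (kk a).down k)) =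
      WidePullback.base (fun a => c.hom (kk a).down) ≫ 𝔭.proj (c.p.obj k) :=
  (c.isLimitLevelObj n kk k).fac (c.levelConeAux n kk k) none

/-- Two maps into `ν(V_{a₀,k} ×_{U_{pk}} ⋯)` agree if they agree after the projections.
[folklore] -/
lemma hom_ext_levelObj {T : X.ProEt} (k : c.K) {f g : T ⟶ (etaleToProet X).obj (c.levelObj n kk k)}
    (hπ : ∀ a, f ≫ (etaleToProet X).map (WidePullback.π (fun a => c.τ' (kk a).down k) a) =
      g ≫ (etaleToProet X).map (WidePullback.π (fun a => c.τ' (kk a).down k) a))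
    (hb : f ≫ (etaleToProet X).map (WidePullback.base (fun a => c.τ' (kk a).down k)) =
      g ≫ (etaleToProet X).map (WidePullback.base (fun a => c.τ' (kk a).down k))) :
    f = g :=
  (c.isLimitLevelObj n kk k).hom_ext fun j => match j with
    | none => hb
    | some a => hπ a

/-- The projections `levelπ` are compatible with the transition maps. [folklore] -/
@[reassoc]
lemma levelπ_comp {k k' : c.K} (g : k ⟶ k') :
    c.levelπ n kk k ≫ (etaleToProet X).map (c.levelMap n kk g) = c.levelπ n kk k' := by
  apply c.hom_ext_levelObj n kk k'
  · intro a
    rw [Category.assoc, ← CategoryTheory.Functor.map_comp, levelMap_π, CategoryTheory.Functor.map_comp,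
      levelπ_map_π_assoc, levelπ_map_π, ρ'_comp]
  · rw [Category.assoc, ← CategoryTheory.Functor.map_comp, levelMap_base,
      CategoryTheory.Functor.map_comp, levelπ_map_base_assoc, levelπ_map_base,
      ProetAffinePresentation.proj_comp]

/-- The projections `V_{a₀} ×_W ⋯ → ν(V_{a₀,k} ×_{U_{pk}} ⋯)` form a cone. [folklore] -/
def levelCone : Cone (c.levelDiagram n kk ⋙ etaleToProet X) where
  pt := c.prod n kk
  π :=
    { app := fun k => c.levelπ n kk k
      naturality := fun k k' g => by
        change 𝟙 _ ≫ c.levelπ n kk k' = c.levelπ n kk k ≫ (etaleToProet X).map (c.levelMap n kk g)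
        rw [Category.id_comp, levelπ_comp] }

/-- The legs of `levelCone` (by `rfl`). [folklore] -/
lemma levelCone_π_app (k : c.K) : (c.levelCone n kk).π.app k = c.levelπ n kk k := rfl

/-! #### `V_{a₀} ×_W ⋯ ×_W V_{aₙ} = lim_k (V_{a₀,k} ×_{U_{pk}} ⋯ ×_{U_{pk}} V_{aₙ,k})` as `X`-schemes -/

variable {n kk}

/-- Abbreviation: the forgetful functor `X_proét → Sch/X`. -/
local notation "Fg" => Scheme.ProEt.forget X
/-- Abbreviation: `ν : X_ét → X_proét`. -/
local notation "ν" => etaleToProet X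

section Clean

/-! Auxiliary identities between composites of `X`-scheme morphisms, stated for morphisms with
their types spelled out (so that rewriting is insensitive to how cone legs are typed). -/

variable {T : Over X}

/-- Auxiliary. [folklore] -/
lemma comp_levelMap_π {k k' : c.K} (g : k ⟶ k') (a : Fin (n + 1))
    (sk : T ⟶ (Fg).obj ((ν).obj (c.levelObj n kk k))) :
    (sk ≫ (Fg).map ((ν).map (c.levelMap n kk g))) ≫
        (Fg).map ((ν).map (WidePullback.π (fun a => c.τ' (kk a).down k') a)) =
      (sk ≫ (Fg).map ((ν).map (WidePullback.π (fun a => c.τ' (kk a).down k) a))) ≫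
        (Fg).map ((ν).map ((c.diagram (kk a).down).map g)) := by
  rw [Category.assoc, Category.assoc, ← (Fg).map_comp, ← (Fg).map_comp, ← (ν).map_comp,
    ← (ν).map_comp, levelMap_π]

/-- Auxiliary. [folklore] -/
lemma comp_levelMap_base {k k' : c.K} (g : k ⟶ k')
    (sk : T ⟶ (Fg).obj ((ν).obj (c.levelObj n kk k))) :
    (sk ≫ (Fg).map ((ν).map (c.levelMap n kk g))) ≫
        (Fg).map ((ν).map (WidePullback.base fun a => c.τ' (kk a).down k')) =
      (sk ≫ (Fg).map ((ν).map (WidePullback.base fun a => c.τ' (kk a).down k))) ≫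
        (Fg).map ((ν).map (𝔭.diagram.map (c.p.map g))) := by
  rw [Category.assoc, Category.assoc, ← (Fg).map_comp, ← (Fg).map_comp, ← (ν).map_comp,
    ← (ν).map_comp, levelMap_base]

/-- Auxiliary. [folklore] -/
lemma comp_hom_proj {k : c.K} (a : Fin (n + 1)) (t : T ⟶ (Fg).obj (c.V (kk a).down))
    (sk : T ⟶ (Fg).obj ((ν).obj (c.levelObj n kk k)))
    (ht : t ≫ (Fg).map (c.ρ' (kk a).down k) =
      sk ≫ (Fg).map ((ν).map (WidePullback.π (fun a => c.τ' (kk a).down k) a))) :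
    (t ≫ (Fg).map (c.hom (kk a).down)) ≫ (Fg).map (𝔭.proj (c.p.obj k)) =
      sk ≫ (Fg).map ((ν).map (WidePullback.base fun a => c.τ' (kk a).down k)) := by
  rw [Category.assoc, ← (Fg).map_comp, ← c.ρ'_τ' _ k, (Fg).map_comp, ← Category.assoc, ht,
    Category.assoc, ← (Fg).map_comp, ← (ν).map_comp, WidePullback.π_arrow]

/-- Auxiliary. [folklore] -/
lemma comp_levelπ_π {k : c.K} (a : Fin (n + 1)) (l : T ⟶ (Fg).obj (c.prod n kk))
    (t : T ⟶ (Fg).obj (c.V (kk a).down)) (sk : T ⟶ (Fg).obj ((ν).obj (c.levelObj n kk k)))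
    (hl : l ≫ (Fg).map (WidePullback.π (fun a => c.hom (kk a).down) a) = t)
    (ht : t ≫ (Fg).map (c.ρ' (kk a).down k) =
      sk ≫ (Fg).map ((ν).map (WidePullback.π (fun a => c.τ' (kk a).down k) a))) :
    (l ≫ (Fg).map (c.levelπ n kk k)) ≫ (Fg).map ((ν).map (WidePullback.π (fun a => c.τ' (kk a).down k) a)) =
      sk ≫ (Fg).map ((ν).map (WidePullback.π (fun a => c.τ' (kk a).down k) a)) := by
  rw [Category.assoc, ← (Fg).map_comp, levelπ_map_π, (Fg).map_comp, ← Category.assoc, hl, ht]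

/-- Auxiliary. [folklore] -/
lemma comp_levelπ_base {k : c.K} (l : T ⟶ (Fg).obj (c.prod n kk)) (t : T ⟶ (Fg).obj W)
    (sk : T ⟶ (Fg).obj ((ν).obj (c.levelObj n kk k)))
    (hl : l ≫ (Fg).map (WidePullback.base fun a => c.hom (kk a).down) = t)
    (ht : t ≫ (Fg).map (𝔭.proj (c.p.obj k)) =
      sk ≫ (Fg).map ((ν).map (WidePullback.base fun a => c.τ' (kk a).down k))) :
    (l ≫ (Fg).map (c.levelπ n kk k)) ≫ (Fg).map ((ν).map (WidePullback.base fun a => c.τ' (kk a).down k)) =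
      sk ≫ (Fg).map ((ν).map (WidePullback.base fun a => c.τ' (kk a).down k)) := by
  rw [Category.assoc, ← (Fg).map_comp, levelπ_map_base, (Fg).map_comp, ← Category.assoc, hl, ht]

/-- Auxiliary. [folklore] -/
lemma comp_π_ρ' {k : c.K} (a : Fin (n + 1)) (m : T ⟶ (Fg).obj (c.prod n kk))
    (sk : T ⟶ (Fg).obj ((ν).obj (c.levelObj n kk k))) (hm : m ≫ (Fg).map (c.levelπ n kk k) = sk) :
    (m ≫ (Fg).map (WidePullback.π (fun a => c.hom (kk a).down) a)) ≫ (Fg).map (c.ρ' (kk a).down k) =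
      sk ≫ (Fg).map ((ν).map (WidePullback.π (fun a => c.τ' (kk a).down k) a)) := by
  rw [Category.assoc, ← (Fg).map_comp, ← levelπ_map_π, (Fg).map_comp, ← Category.assoc, hm]

/-- Auxiliary. [folklore] -/
lemma comp_base_proj {k : c.K} (m : T ⟶ (Fg).obj (c.prod n kk))
    (sk : T ⟶ (Fg).obj ((ν).obj (c.levelObj n kk k))) (hm : m ≫ (Fg).map (c.levelπ n kk k) = sk) :
    (m ≫ (Fg).map (WidePullback.base fun a => c.hom (kk a).down)) ≫ (Fg).map (𝔭.proj (c.p.obj k)) =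
      sk ≫ (Fg).map ((ν).map (WidePullback.base fun a => c.τ' (kk a).down k)) := by
  rw [Category.assoc, ← (Fg).map_comp, ← levelπ_map_base, (Fg).map_comp, ← Category.assoc, hm]

end Clean

/-- From a cone over the levelwise fibre products: the cone over `k ↦ V_{a,k}` given by the `a`-th
projections. [folklore] -/
def coneπ (s : Cone ((c.levelDiagram n kk ⋙ ν) ⋙ Fg)) (a : Fin (n + 1)) :
    Cone ((c.diagram (kk a).down ⋙ ν) ⋙ Fg) where
  pt := s.pt
  π :=
    { app := fun k => s.π.app k ≫ (Fg).map ((ν).map (WidePullback.π (fun a => c.τ' (kk a).down k) a))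
      naturality := fun k k' g => by
        have hs := s.π.naturality g
        change 𝟙 _ ≫ s.π.app k' = s.π.app k ≫ (Fg).map ((ν).map (c.levelMap n kk g)) at hs
        rw [Category.id_comp] at hs
        change 𝟙 _ ≫ (s.π.app k' ≫ (Fg).map ((ν).map (WidePullback.π (fun a => c.τ' (kk a).down k') a))) =
          (s.π.app k ≫ (Fg).map ((ν).map (WidePullback.π (fun a => c.τ' (kk a).down k) a))) ≫
            (Fg).map ((ν).map ((c.diagram (kk a).down).map g))
        rw [Category.id_comp, hs]
        exact c.comp_levelMap_π g a (s.π.app k) }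

/-- From a cone over the levelwise fibre products: the cone over `k ↦ U_{p k}` given by the base
maps. [folklore] -/
def coneBase (s : Cone ((c.levelDiagram n kk ⋙ ν) ⋙ Fg)) :
    Cone (c.p ⋙ ((𝔭.diagram ⋙ ν) ⋙ Fg)) where
  pt := s.pt
  π :=
    { app := fun k => s.π.app k ≫ (Fg).map ((ν).map (WidePullback.base fun a => c.τ' (kk a).down k))
      naturality := fun k k' g => by
        have hs := s.π.naturality g
        change 𝟙 _ ≫ s.π.app k' = s.π.app k ≫ (Fg).map ((ν).map (c.levelMap n kk g)) at hs
        rw [Category.id_comp] at hs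
        change 𝟙 _ ≫ (s.π.app k' ≫ (Fg).map ((ν).map (WidePullback.base fun a => c.τ' (kk a).down k'))) =
          (s.π.app k ≫ (Fg).map ((ν).map (WidePullback.base fun a => c.τ' (kk a).down k))) ≫
            (Fg).map ((ν).map (𝔭.diagram.map (c.p.map g)))
        rw [Category.id_comp, hs]
        exact c.comp_levelMap_base g (s.π.app k) }

/-- `W = lim_k U_{p k}` (reindexing the presentation of `W` along the initial functor `p`).
[folklore] -/
def isLimitWhisker : IsLimit (((Fg).mapCone (Cone.mk W 𝔭.π)).whisker c.p) :=
  (Functor.Initial.isLimitWhiskerEquiv c.p _).symm 𝔭.isLimit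

/-- The `V_a`-limit applied to the `a`-th projection cone. [folklore] -/
def liftπ (s : Cone ((c.levelDiagram n kk ⋙ ν) ⋙ Fg)) (a : Fin (n + 1)) : s.pt ⟶ (Fg).obj (c.V (kk a).down) :=
  (c.isLimit (kk a).down).lift (c.coneπ s a)

/-- `liftπ` followed by the projection to `V_{a,k}`. [folklore] -/
lemma liftπ_ρ' (s : Cone ((c.levelDiagram n kk ⋙ ν) ⋙ Fg)) (a : Fin (n + 1)) (k : c.K) :
    c.liftπ s a ≫ (Fg).map (c.ρ' (kk a).down k) =
      s.π.app k ≫ (Fg).map ((ν).map (WidePullback.π (fun a => c.τ' (kk a).down k) a)) :=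
  c.isLimit_fac _ (c.coneπ s a) k

/-- The `W`-limit applied to the base cone. [folklore] -/
def liftBase (s : Cone ((c.levelDiagram n kk ⋙ ν) ⋙ Fg)) : s.pt ⟶ (Fg).obj W :=
  c.isLimitWhisker.lift (c.coneBase s)

/-- `liftBase` followed by the projection to `U_{p k}`. [folklore] -/
lemma liftBase_proj (s : Cone ((c.levelDiagram n kk ⋙ ν) ⋙ Fg)) (k : c.K) :
    c.liftBase s ≫ (Fg).map (𝔭.proj (c.p.obj k)) =
      s.π.app k ≫ (Fg).map ((ν).map (WidePullback.base fun a => c.τ' (kk a).down k)) :=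
  c.isLimitWhisker.fac (c.coneBase s) k

/-- Uniqueness for the `W`-limit. [folklore] -/
lemma isLimitWhisker_uniq (s : Cone (c.p ⋙ ((𝔭.diagram ⋙ ν) ⋙ Fg)))
    (m : s.pt ⟶ (Fg).obj W) (hm : ∀ k, m ≫ (Fg).map (𝔭.proj (c.p.obj k)) = s.π.app k) :
    m = c.isLimitWhisker.lift s :=
  c.isLimitWhisker.uniq s m hm

/-- The lifts to `V_a` and `W` are compatible with `V_a → W`. [folklore] -/
lemma liftπ_hom (s : Cone ((c.levelDiagram n kk ⋙ ν) ⋙ Fg)) (a : Fin (n + 1)) :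
    c.liftπ s a ≫ (Fg).map (c.hom (kk a).down) = c.liftBase s := by
  apply c.isLimitWhisker_uniq (c.coneBase s)
  intro k
  exact c.comp_hom_proj a (c.liftπ s a) (s.π.app k) (c.liftπ_ρ' s a k)

/-- `V_{a₀} ×_W ⋯ ×_W V_{aₙ}` is a wide pullback of `X`-schemes (`Fg` preserves finite limits).
[folklore] -/
def isLimitProdForget :
    IsLimit ((Fg).mapCone (limit.cone (WidePullbackShape.wideCospan W
      (fun a : Fin (n + 1) => c.V (kk a).down) (fun a => c.hom (kk a).down)))) :=
  isLimitOfPreserves (Fg) (limit.isLimit _)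

/-- The induced map to `V_{a₀} ×_W ⋯ ×_W V_{aₙ}`. [folklore] -/
def liftProd (s : Cone ((c.levelDiagram n kk ⋙ ν) ⋙ Fg)) : s.pt ⟶ (Fg).obj (c.prod n kk) :=
  c.isLimitProdForget.lift
    (WidePullbackShape.mkCone
      (F := WidePullbackShape.wideCospan W (fun a : Fin (n + 1) => c.V (kk a).down)
        (fun a => c.hom (kk a).down) ⋙ Fg)
      (c.liftBase s) (fun a => c.liftπ s a) (fun a => c.liftπ_hom s a))

/-- `liftProd` followed by a projection to `V_a`. [folklore] -/
lemma liftProd_π (s : Cone ((c.levelDiagram n kk ⋙ ν) ⋙ Fg)) (a : Fin (n + 1)) :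
    c.liftProd s ≫ (Fg).map (WidePullback.π (fun a => c.hom (kk a).down) a) = c.liftπ s a :=
  c.isLimitProdForget.fac _ (some a)

/-- `liftProd` followed by the projection to `W`. [folklore] -/
lemma liftProd_base (s : Cone ((c.levelDiagram n kk ⋙ ν) ⋙ Fg)) :
    c.liftProd s ≫ (Fg).map (WidePullback.base fun a => c.hom (kk a).down) = c.liftBase s :=
  c.isLimitProdForget.fac _ none

/-- `ν(V_{a₀,k} ×_{U_{pk}} ⋯)` is a wide pullback of `X`-schemes. [folklore] -/
def isLimitLevelObjForget (k : c.K) :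
    IsLimit ((ν ⋙ Fg).mapCone (limit.cone (WidePullbackShape.wideCospan
      (𝔭.diagram.obj (c.p.obj k)) (fun a : Fin (n + 1) => (c.diagram (kk a).down).obj k)
      (fun a => c.τ' (kk a).down k)))) :=
  isLimitOfPreserves (ν ⋙ Fg) (limit.isLimit _)

/-- Two maps into the `X`-scheme `ν(V_{a₀,k} ×_{U_{pk}} ⋯)` agree if they agree after the projections.
[folklore] -/
lemma hom_ext_forget_levelObj {T : Over X} (k : c.K)
    {f g : T ⟶ (Fg).obj ((ν).obj (c.levelObj n kk k))}
    (hπ : ∀ a, f ≫ (Fg).map ((ν).map (WidePullback.π (fun a => c.τ' (kk a).down k) a)) =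
      g ≫ (Fg).map ((ν).map (WidePullback.π (fun a => c.τ' (kk a).down k) a)))
    (hb : f ≫ (Fg).map ((ν).map (WidePullback.base fun a => c.τ' (kk a).down k)) =
      g ≫ (Fg).map ((ν).map (WidePullback.base fun a => c.τ' (kk a).down k))) :
    f = g :=
  (c.isLimitLevelObjForget k).hom_ext fun j => match j with
    | none => hb
    | some a => hπ a

/-- Two maps into the `X`-scheme `V_{a₀} ×_W ⋯ ×_W V_{aₙ}` agree if they agree after the projections.
[folklore] -/
lemma hom_ext_forget_prod {T : Over X} {f g : T ⟶ (Fg).obj (c.prod n kk)}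
    (hπ : ∀ a, f ≫ (Fg).map (WidePullback.π (fun a => c.hom (kk a).down) a) =
      g ≫ (Fg).map (WidePullback.π (fun a => c.hom (kk a).down) a))
    (hb : f ≫ (Fg).map (WidePullback.base fun a => c.hom (kk a).down) =
      g ≫ (Fg).map (WidePullback.base fun a => c.hom (kk a).down)) :
    f = g :=
  c.isLimitProdForget.hom_ext fun j => match j with
    | none => hb
    | some a => hπ a

variable (n kk) in
/-- **`V_{a₀} ×_W ⋯ ×_W V_{aₙ} = lim_k (V_{a₀,k} ×_{U_{pk}} ⋯ ×_{U_{pk}} V_{aₙ,k})` as `X`-schemes**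
(limits commute with limits; Bhatt–Scholze Remark 4.2.3: connected limits of pro-étale affines
are pro-étale affines, computed in `Sch/X`). [cite: BhattScholze2015, Remark 4.2.3] -/
def levelConeIsLimit : IsLimit ((Fg).mapCone (c.levelCone n kk)) where
  lift s := c.liftProd s
  fac s k := by
    change c.liftProd s ≫ (Fg).map (c.levelπ n kk k) = s.π.app k
    apply c.hom_ext_forget_levelObj k
    · intro a
      exact c.comp_levelπ_π a (c.liftProd s) (c.liftπ s a) (s.π.app k) (c.liftProd_π s a)
        (c.liftπ_ρ' s a k)
    · exact c.comp_levelπ_base (c.liftProd s) (c.liftBase s) (s.π.app k) (c.liftProd_base s)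
        (c.liftBase_proj s k)
  uniq s m hm := by
    apply c.hom_ext_forget_prod
    · intro a
      rw [liftProd_π]
      apply c.isLimit_uniq _ (c.coneπ s a)
      intro k
      exact c.comp_π_ρ' a m (s.π.app k) (hm k)
    · rw [liftProd_base]
      apply c.isLimitWhisker_uniq (c.coneBase s)
      intro k
      exact c.comp_base_proj m (s.π.app k) (hm k)

variable (n kk) in
/-- **The presentation of `V_{a₀} ×_W ⋯ ×_W V_{aₙ}`** by the levelwise fibre products.
[cite: BhattScholze2015, Remark 4.2.3] -/
def prodPresentation : ProetAffinePresentation X (c.prod n kk) where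
  ι := c.K
  diagram := c.levelDiagram n kk
  isAffine := c.isAffine_levelObj_left n kk
  π := (c.levelCone n kk).π
  isLimit := c.levelConeIsLimit n kk

variable (n kk) in
/-- The wide pullbacks of the covering family `(V_a → W)_a` used by Cartan's criterion are
pro-étale affines. [cite: BhattScholze2015, Remark 4.2.3] -/
theorem isProetAffine_cechWidePullback :
    isProetAffine X (Literature.Algebra.Homology.cechWidePullback c.family.f kk) :=
  ⟨c.prodPresentation n kk⟩

end PresentedCover

end PresentedCover


/-! ### The Čech complex of `ν*F` on a presented cover is a filtered colimit of étale Čech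
complexes (Bhatt–Scholze, proof of Cor. 5.1.6) -/

namespace PresentedCover

open Literature.Algebra.Homology Literature.Algebra.Homology.CechFamily

variable {W : X.ProEt} {𝔭 : ProetAffinePresentation X W} (c : PresentedCover 𝔭)

/-- Abbreviation: `ν : X_ét → X_proét`. -/
local notation "ν" => etaleToProet X

/-- The levelwise family `(V_{a,k} → U_{pk})_a` at level `k`, indexed like `c.family`. [folklore] -/
abbrev levelArrows (k : c.K) :
    ∀ a : ULift.{uS + 1} (Fin c.r), (c.diagram a.down).obj k ⟶ 𝔭.diagram.obj (c.p.obj k) :=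
  fun a => c.τ' a.down k

/-! #### Face maps upstairs and downstairs -/

/-- **The projections intertwine the face maps**: `δᵢ ≫ levelπ_m = levelπ_{m+1} ≫ ν(δᵢ)`.
[folklore] -/
@[reassoc]
lemma cechδ_levelπ (m : ℕ) (kk : Fin (m + 2) → ULift.{uS + 1} (Fin c.r)) (i : Fin (m + 2)) (k : c.K) :
    cechδ c.family.f kk i ≫ c.levelπ m (fun a => kk (faceMap i a)) k =
      c.levelπ (m + 1) kk k ≫ (ν).map (cechδ (c.levelArrows k) kk i) := by
  apply c.hom_ext_levelObj m (fun a => kk (faceMap i a)) k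
  · intro a
    rw [Category.assoc, levelπ_map_π, cechδ_π_assoc, Category.assoc, ← (ν).map_comp, cechδ_π,
      levelπ_map_π]
  · rw [Category.assoc, levelπ_map_base, cechδ_base_assoc, Category.assoc, ← (ν).map_comp,
      cechδ_base, levelπ_map_base]

/-- The levelwise face maps commute with the transition maps. [folklore] -/
@[reassoc]
lemma cechδ_levelMap (m : ℕ) (kk : Fin (m + 2) → ULift.{uS + 1} (Fin c.r)) (i : Fin (m + 2))
    {k k' : c.K} (f : k ⟶ k') :
    cechδ (c.levelArrows k) kk i ≫ c.levelMap m (fun a => kk (faceMap i a)) f =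
      c.levelMap (m + 1) kk f ≫ cechδ (c.levelArrows k') kk i := by
  apply WidePullback.hom_ext
  · intro a
    rw [Category.assoc, levelMap_π, cechδ_π_assoc, Category.assoc, cechδ_π, levelMap_π]
  · rw [Category.assoc, levelMap_base, cechδ_base_assoc, Category.assoc, cechδ_base, levelMap_base]

/-- `levelMap` is functorial. [folklore] -/
lemma levelMap_comp' (m : ℕ) (kk : Fin (m + 1) → ULift.{uS + 1} (Fin c.r)) {k k' k'' : c.K}
    (f : k ⟶ k') (g : k' ⟶ k'') : c.levelMap m kk (f ≫ g) = c.levelMap m kk f ≫ c.levelMap m kk g :=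
  (c.levelDiagram m kk).map_comp f g

/-! #### Lemma 5.1.1 for the fibre products: the legs `F(V_{a₀,k} ×_{U_{pk}} ⋯) → ν*F(V_{a₀} ×_W ⋯)` -/

variable (F : Sheaf X.smallEtaleTopology Ab.{uS + 1}) (m : ℕ) (kk : Fin (m + 1) → ULift.{uS + 1} (Fin c.r))

/-- The leg `F(V_{a₀,k} ×_{U_{pk}} ⋯) → ν*F(V_{a₀} ×_W ⋯ ×_W V_{aₘ})` of the sections cocone of the
presentation of the fibre product (Bhatt–Scholze Lemma 5.1.1: unit followed by restriction).
[cite: BhattScholze2015, Lemma 5.1.1] -/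
def leg (k : c.K) : F.obj.obj (op (c.levelObj m kk k)) ⟶
    ((etaleToProetPullback X).obj F).obj.obj (op (c.prod m kk)) :=
  ((c.prodPresentation m kk).sectionsCocone F).ι.app (op k)

/-- The leg, unfolded: `η_F(V_{a₀,k} ×_{U_{pk}} ⋯)` followed by restriction along `levelπ`.
[cite: BhattScholze2015, Lemma 5.1.1] -/
lemma leg_eq (k : c.K) : c.leg F m kk k =
    ((etaleToProetAdjunction X).unit.app F).hom.app (op (c.levelObj m kk k)) ≫
      ((etaleToProetPullback X).obj F).obj.map (c.levelπ m kk k).op :=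
  (c.prodPresentation m kk).sectionsCocone_ι_app F (op k)

/-- The legs are compatible with the transition maps. [cite: BhattScholze2015, Lemma 5.1.1] -/
lemma leg_map_levelMap {k k' : c.K} (f : k' ⟶ k) (x : F.obj.obj (op (c.levelObj m kk k))) :
    c.leg F m kk k' (F.obj.map (c.levelMap m kk f).op x) = c.leg F m kk k x := by
  have h := ((c.prodPresentation m kk).sectionsCocone F).w f.op
  exact ConcreteCategory.congr_hom h x

variable {m kk} in
/-- **The legs commute with the face maps**: `leg (δᵢ^* x) = δᵢ^* (leg x)` (naturality of the
unit `F → ν_*ν*F` and `cechδ_levelπ`). [cite: BhattScholze2015, Lemma 5.1.1] -/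
lemma leg_map_cechδ (kk : Fin (m + 2) → ULift.{uS + 1} (Fin c.r)) (i : Fin (m + 2)) (k : c.K)
    (x : F.obj.obj (op (c.levelObj m (fun a => kk (faceMap i a)) k))) :
    c.leg F (m + 1) kk k (F.obj.map (cechδ (c.levelArrows k) kk i).op x) =
      ((etaleToProetPullback X).obj F).obj.map (cechδ c.family.f kk i).op
        (c.leg F m (fun a => kk (faceMap i a)) k x) := by
  rw [leg_eq, leg_eq]
  change ((F.obj.map (cechδ (c.levelArrows k) kk i).op ≫
      ((etaleToProetAdjunction X).unit.app F).hom.app (op (c.levelObj (m + 1) kk k))) ≫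
        ((etaleToProetPullback X).obj F).obj.map (c.levelπ (m + 1) kk k).op) x =
    ((((etaleToProetAdjunction X).unit.app F).hom.app
        (op (c.levelObj m (fun a => kk (faceMap i a)) k)) ≫
      ((etaleToProetPullback X).obj F).obj.map (c.levelπ m (fun a => kk (faceMap i a)) k).op) ≫
        ((etaleToProetPullback X).obj F).obj.map (cechδ c.family.f kk i).op) x
  erw [((etaleToProetAdjunction X).unit.app F).hom.naturality (cechδ (c.levelArrows k) kk i).op]
  have hmor : ((etaleToProetPullback X).obj F).obj.map ((ν).map (cechδ (c.levelArrows k) kk i)).op ≫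
      ((etaleToProetPullback X).obj F).obj.map (c.levelπ (m + 1) kk k).op =
        ((etaleToProetPullback X).obj F).obj.map (c.levelπ m (fun a => kk (faceMap i a)) k).op ≫
          ((etaleToProetPullback X).obj F).obj.map (cechδ c.family.f kk i).op := by
    rw [← Functor.map_comp, ← Functor.map_comp, ← op_comp, ← op_comp, cechδ_levelπ]
  exact congrArg (fun φ => ((((etaleToProetAdjunction X).unit.app F).hom.app
    (op (c.levelObj m (fun a => kk (faceMap i a)) k))) ≫ φ) x) hmor

variable {m kk} in
/-- **The legs commute with the Čech differentials** of the section models.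
[cite: BhattScholze2015, Lemma 5.1.1] -/
lemma leg_cechD (k : c.K)
    (s : ∀ kk : Fin (m + 1) → ULift.{uS + 1} (Fin c.r), F.obj.obj (op (c.levelObj m kk k)))
    (kk' : Fin (m + 2) → ULift.{uS + 1} (Fin c.r)) :
    c.leg F (m + 1) kk' k (cechD (c.levelArrows k) F.obj m s kk') =
      cechD c.family.f ((etaleToProetPullback X).obj F).obj m (fun kk => c.leg F m kk k (s kk)) kk' := by
  unfold cechD
  rw [map_sum]
  refine Finset.sum_congr rfl fun i _ => ?_
  rw [map_zsmul, leg_map_cechδ]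

variable {m kk} in
/-- The levelwise Čech differentials commute with the transition maps. [folklore] -/
lemma map_levelMap_cechD {k k' : c.K} (f : k' ⟶ k)
    (s : ∀ kk : Fin (m + 1) → ULift.{uS + 1} (Fin c.r), F.obj.obj (op (c.levelObj m kk k)))
    (kk' : Fin (m + 2) → ULift.{uS + 1} (Fin c.r)) :
    F.obj.map (c.levelMap (m + 1) kk' f).op (cechD (c.levelArrows k) F.obj m s kk') =
      cechD (c.levelArrows k') F.obj m (fun kk => F.obj.map (c.levelMap m kk f).op (s kk)) kk' := by
  unfold cechD
  rw [map_sum]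
  refine Finset.sum_congr rfl fun i _ => ?_
  rw [map_zsmul]
  congr 1
  change (F.obj.map _ ≫ F.obj.map _) (s _) = (F.obj.map _ ≫ F.obj.map _) (s _)
  rw [← Functor.map_comp, ← Functor.map_comp, ← op_comp, ← op_comp, cechδ_levelMap]

/-- `forget Ab` preserves the (small filtered) colimit of the sections diagram (Mathlib's filtered
colimits of abelian groups are computed on underlying types). [folklore] -/
instance preservesColimit_forget_levelDiagram :
    PreservesColimit ((c.prodPresentation m kk).diagram.op ⋙ F.obj) (forget Ab.{uS + 1}) :=
  preservesColimit_of_preserves_colimit_cocone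
    (AddCommGrpCat.FilteredColimits.colimitCoconeIsColimit.{uS, uS + 1} _)
    (Types.TypeMax.colimitCoconeIsColimit.{uS, uS + 1} (_ ⋙ forget AddCommGrpCat.{uS + 1}))

/-- The colimit structure of Bhatt–Scholze Lemma 5.1.1 for `V_{a₀} ×_W ⋯ = lim_k V_{a₀,k} ×_{U_{pk}} ⋯`
(`nonempty_isColimit_sectionsCocone_etaleToProetPullback_holds`). [cite: BhattScholze2015, Lemma 5.1.1] -/
def isColimitLegs : IsColimit ((c.prodPresentation m kk).sectionsCocone F) :=
  (nonempty_isColimit_sectionsCocone_etaleToProetPullback_holds X (c.prod m kk)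
    (c.prodPresentation m kk) F).some

/-- **Every section of `ν*F` over `V_{a₀} ×_W ⋯ ×_W V_{aₘ}` comes from some level.**
[cite: BhattScholze2015, Lemma 5.1.1] -/
lemma exists_leg_eq (s : ((etaleToProetPullback X).obj F).obj.obj (op (c.prod m kk))) :
    ∃ (k : c.K) (x : F.obj.obj (op (c.levelObj m kk k))), c.leg F m kk k x = s := by
  obtain ⟨⟨k⟩, x, hx⟩ := Types.jointly_surjective_of_isColimit
    (isColimitOfPreserves (forget Ab.{uS + 1}) (c.isColimitLegs F m kk)) s
  exact ⟨k, x, hx⟩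

/-- **A section dying in `ν*F(V_{a₀} ×_W ⋯)` dies at some level.** [cite: BhattScholze2015, Lemma 5.1.1] -/
lemma exists_map_levelMap_eq_zero (k : c.K) (x : F.obj.obj (op (c.levelObj m kk k)))
    (hx : c.leg F m kk k x = 0) :
    ∃ (k' : c.K) (f : k' ⟶ k), F.obj.map (c.levelMap m kk f).op x = 0 := by
  have h0 : c.leg F m kk k x = c.leg F m kk k 0 := by rw [hx, map_zero]
  obtain ⟨⟨k''⟩, f, g, hfg⟩ := Concrete.isColimit_exists_of_rep_eq
    ((c.prodPresentation m kk).diagram.op ⋙ F.obj)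
    (c.isColimitLegs F m kk) x (0 : F.obj.obj (op (c.levelObj m kk k))) h0
  refine ⟨k'', f.unop, ?_⟩
  have : ((c.prodPresentation m kk).diagram.op ⋙ F.obj).map g
      (0 : F.obj.obj (op (c.levelObj m kk k))) = 0 :=
    map_zero _
  rw [this] at hfg
  exact hfg

variable {F m kk}

/-- Finitely many levels have a common refinement. [folklore] -/
lemma exists_common_level {ι : Type*} [Fintype ι] (k : ι → c.K) :
    ∃ k₀ : c.K, ∀ i, Nonempty (k₀ ⟶ k i) := by
  classical
  obtain ⟨k₀, hk₀⟩ := IsCofiltered.inf_objs_exists (Finset.univ.image k)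
  exact ⟨k₀, fun i => hk₀ (Finset.mem_image_of_mem k (Finset.mem_univ i))⟩

variable (F m) in
/-- **Finitely many sections dying upstairs die at a common level.** [cite: BhattScholze2015, Lemma 5.1.1] -/
lemma exists_levelMap_kills {ι : Type*} (S : Finset ι) (kk : ι → (Fin (m + 1) → ULift.{uS + 1} (Fin c.r)))
    (k₀ : c.K) (y : ∀ i, F.obj.obj (op (c.levelObj m (kk i) k₀)))
    (hy : ∀ i ∈ S, c.leg F m (kk i) k₀ (y i) = 0) :
    ∃ (k₁ : c.K) (g : k₁ ⟶ k₀), ∀ i ∈ S, F.obj.map (c.levelMap m (kk i) g).op (y i) = 0 := by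
  classical
  induction S using Finset.induction with
  | empty => exact ⟨k₀, 𝟙 _, fun i hi => absurd hi (Finset.notMem_empty i)⟩
  | insert i₀ S hi₀ ih =>
    obtain ⟨k₁, g, hg⟩ := ih (fun i hi => hy i (Finset.mem_insert_of_mem hi))
    have h0 : c.leg F m (kk i₀) k₁ (F.obj.map (c.levelMap m (kk i₀) g).op (y i₀)) = 0 := by
      rw [leg_map_levelMap]
      exact hy i₀ (Finset.mem_insert_self i₀ S)
    obtain ⟨k₂, h, hh⟩ := c.exists_map_levelMap_eq_zero F m (kk i₀) k₁ _ h0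
    refine ⟨k₂, h ≫ g, fun i hi => ?_⟩
    rw [levelMap_comp', op_comp, Functor.map_comp, ConcreteCategory.comp_apply]
    rcases Finset.mem_insert.mp hi with rfl | hi
    · exact hh
    · rw [hg i hi, map_zero]

variable (F) in
/-- **Exactness of the section model upstairs from exactness downstairs.** If at every level `k`
the Čech section complexes of `F` for the family `(V_{a,k} → U_{pk})_a` are exact in positive
degrees, then so is the Čech section complex of `ν*F` for `(V_a → W)_a`: a cocycle comes from a
common level, its differential dies at a further common level, where it becomes a coboundary
(Bhatt–Scholze: "`RΓ(U, ν*K)` is a filtered colimit of the `RΓ(U_i, K)` … filtered colimits are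
exact"). [cite: BhattScholze2015, Cor. 5.1.6 (proof)] -/
theorem sections_exact
    (hF : ∀ (k : c.K) (m : ℕ)
      (s : ∀ kk : Fin (m + 2) → ULift.{uS + 1} (Fin c.r), F.obj.obj (op (c.levelObj (m + 1) kk k))),
      cechD (c.levelArrows k) F.obj (m + 1) s = 0 →
        ∃ t : ∀ kk : Fin (m + 1) → ULift.{uS + 1} (Fin c.r), F.obj.obj (op (c.levelObj m kk k)),
          cechD (c.levelArrows k) F.obj m t = s)
    (m : ℕ) (s : ∀ kk : Fin (m + 2) → ULift.{uS + 1} (Fin c.r),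
      ((etaleToProetPullback X).obj F).obj.obj (op (c.prod (m + 1) kk)))
    (hs : cechD c.family.f ((etaleToProetPullback X).obj F).obj (m + 1) s = 0) :
    ∃ t : ∀ kk : Fin (m + 1) → ULift.{uS + 1} (Fin c.r),
        ((etaleToProetPullback X).obj F).obj.obj (op (c.prod m kk)),
      cechD c.family.f ((etaleToProetPullback X).obj F).obj m t = s := by
  -- each `s kk` comes from some level; move all of them to a common level `k₀`
  choose k x hx using fun kk => c.exists_leg_eq F (m + 1) kk (s kk)
  obtain ⟨k₀, hk₀⟩ := c.exists_common_level k
  let x₀ : ∀ kk : Fin (m + 2) → ULift.{uS + 1} (Fin c.r), F.obj.obj (op (c.levelObj (m + 1) kk k₀)) :=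
    fun kk => F.obj.map (c.levelMap (m + 1) kk (hk₀ kk).some).op (x kk)
  have hx₀ : (fun kk => c.leg F (m + 1) kk k₀ (x₀ kk)) = s := funext fun kk => by
    change c.leg F (m + 1) kk k₀ (F.obj.map _ (x kk)) = s kk
    rw [leg_map_levelMap, hx]
  -- the differential of `x₀` dies upstairs, hence at a common further level `k₁`
  have hD : ∀ kk' ∈ (Finset.univ : Finset (Fin (m + 3) → ULift.{uS + 1} (Fin c.r))),
      c.leg F (m + 2) kk' k₀ (cechD (c.levelArrows k₀) F.obj (m + 1) x₀ kk') = 0 := fun kk' _ => by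
    rw [leg_cechD, hx₀]
    exact congrFun hs kk'
  obtain ⟨k₁, g, hg⟩ := c.exists_levelMap_kills F (m + 2) Finset.univ id k₀ _ hD
  -- at level `k₁` the moved cochain is a cocycle, hence a coboundary by `hF`
  let x₁ : ∀ kk : Fin (m + 2) → ULift.{uS + 1} (Fin c.r), F.obj.obj (op (c.levelObj (m + 1) kk k₁)) :=
    fun kk => F.obj.map (c.levelMap (m + 1) kk g).op (x₀ kk)
  have hx₁ : cechD (c.levelArrows k₁) F.obj (m + 1) x₁ = 0 := funext fun kk' => by
    change cechD (c.levelArrows k₁) F.obj (m + 1) (fun kk => F.obj.map (c.levelMap (m + 1) kk g).op (x₀ kk)) kk' = 0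
    rw [← map_levelMap_cechD]
    exact hg kk' (Finset.mem_univ _)
  obtain ⟨t, ht⟩ := hF k₁ m x₁ hx₁
  refine ⟨fun kk => c.leg F m kk k₁ (t kk), funext fun kk' => ?_⟩
  rw [← leg_cechD, ht]
  change c.leg F (m + 1) kk' k₁ (F.obj.map _ (x₀ kk')) = s kk'
  rw [leg_map_levelMap, ← hx₀]

/-- The levelwise family `(V_{a,k} → U_{pk})_a` at level `k`, indexed in `Type`. [folklore] -/
def levelFamily (k : c.K) : PreZeroHypercover.{0} (𝔭.diagram.obj (c.p.obj k)) where
  I₀ := Fin c.r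
  X a := (c.diagram a).obj k
  f a := c.τ' a k

/-- **The Čech complex of `ν*(ulift I)` for a presented cover is exact in positive degrees** for
`I` injective in `Shv(X_ét, Ab.{u})`: levelwise, `ulift I` is Čech-acyclic for the families
`(V_{a,k} → U_{pk})_a` in `X_ét` (Milne III 2.4 for `I`, transported along the coefficient and
index lifts, `cechCochainComplex_uliftFunctor_exactAt_succ`); the section models identify the
Čech complexes with complexes of families of sections over the fibre products
(`cechCochainComplex_exactAt_succ_iff_sections`), and upstairs exactness follows by the
filtered-colimit argument `sections_exact` (Lemma 5.1.1). This is the Čech computation in the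
proof of Bhatt–Scholze Cor. 5.1.6 ("`Ȟᵖ(U, ν*I) = 0` … each `I|_{U_i}` is injective and filtered
colimits are exact"). [cite: BhattScholze2015, Cor. 5.1.6 (proof)] -/
theorem cechCochainComplex_exactAt_succ (I : Sheaf X.smallEtaleTopology Ab.{uS}) [Injective I]
    (m : ℕ) :
    (cechCochainComplex c.family.f ((etaleToProetPullbackULift X).obj I).obj).ExactAt (m + 1) := by
  refine (cechCochainComplex_exactAt_succ_iff_sections c.family.f
    ((etaleToProetPullbackULift X).obj I).obj m).2 ?_
  refine c.sections_exact ((uliftEtSheaf X).obj I) (fun k m' s hs => ?_) m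
  have hlev : (cechCochainComplex (preZeroHypercoverULift.{0, uS, uS + 1, uS + 1}
      (c.levelFamily k)).f ((uliftEtSheaf X).obj I).obj).ExactAt (m' + 1) :=
    cechCochainComplex_uliftFunctor_exactAt_succ (c.levelFamily k) I.obj m'
      (cechCochainComplex_exactAt_succ_of_injective (c.levelFamily k).f X.smallEtaleTopology I m')
  exact (cechCochainComplex_exactAt_succ_iff_sections
    (preZeroHypercoverULift.{0, uS, uS + 1, uS + 1} (c.levelFamily k)).f
    ((uliftEtSheaf X).obj I).obj m').1 hlev s hs

end PresentedCover


/-! ### (A) — étale acyclicity of `ν*(ulift I)` — from Cartan's criterion, modulo the cofinality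
of presented covers (Bhatt–Scholze Thm. 2.3.4) -/

section Cofinal

open Literature.Algebra.Homology Literature.Algebra.Homology.CechFamily

variable (X)

/-- **The `Ext`-vanishing class over `𝔘` is a lifting class**: the pro-étale sheaves `G` with
`Extᵖ(ℤ[h_W], G) = 0` for all `p > 0` and all `W ∈ 𝔘` are stable under injective cosyzygies
(dimension shifting) and their sections over `W ∈ 𝔘` lift along `J → Q` (`H¹(W, G) = 0`).
[folklore] -/
theorem isLiftingClass_extVanishing (𝔘 : Set X.ProEt) :
    IsLiftingClass (Scheme.ProEt.topology X) 𝔘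
      {G | ∀ W ∈ 𝔘, ∀ n : ℕ, Subsingleton (Abelian.Ext.{uS + 1} (proetFreeZ X W) G (n + 1))} where
  mem S hS hJ hG W hW n := by
    haveI := hJ
    haveI := hG W hW (n + 1)
    exact Ext.subsingleton_succ_X₃_of_injective hS _ n
  surjective S hS hJ hG W hW := by
    haveI := hG W hW 0
    exact surjective_app_of_subsingleton_ext_freeZSheaf hS W

variable {X} in
/-- The affine étale objects are pro-étale affines (trivial presentation). [cite: BhattScholze2015, Def. 4.2.1] -/
theorem etaleAffineObjects_subset_isProetAffine :
    etaleAffineObjects X ⊆ {W | isProetAffine X W} := by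
  rintro _ ⟨⟨V, hV⟩, rfl⟩
  haveI := hV
  exact isProetAffine_etaleToProet_obj X V

/-- **(A) from the cofinality of presented covers.** If every pro-étale covering sieve of every
pro-étale affine `W` of `X` contains the arrows `V_a → W` of some presented cover (the consequence
of Bhatt–Scholze Thm. 2.3.4 used in the proof of Cor. 5.1.6: "a cofinal collection of covers of
`U` in `X_proét` is obtained by taking cofiltered limits of affine étale covers obtained via base
change from some `U_i`"), then `ν*(ulift I)` is étale-acyclic for every injective `I`: Cartan's
criterion on `X_proét` (`subsingleton_ext_freeSheaf_of_cech_exactAt`) with `B` the pro-étale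
affines and `Cov` the presented covers — their iterated fibre products are pro-étale affines
(`isProetAffine_cechWidePullback`, Remark 4.2.3) and the Čech complexes of `ν*(ulift I)` on them
are exact in positive degrees (`cechCochainComplex_exactAt_succ`, Lemma 5.1.1 + Milne III 2.4) —
gives the `Ext`-vanishing over all pro-étale affines, a lifting class containing the affine étale
objects. [cite: BhattScholze2015, Cor. 5.1.6 (proof) and Thm. 2.3.4] -/
theorem etaleToProetPullbackULift_mem_etaleAcyclic_of_cofinal
    (hT' : ∀ (W : X.ProEt), isProetAffine X W → ∀ S ∈ Scheme.ProEt.topology X W,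
      ∃ (𝔭 : ProetAffinePresentation X W) (c : PresentedCover 𝔭), ∀ a, S (c.hom a))
    (I : Sheaf X.smallEtaleTopology Ab.{uS}) [Injective I] :
    (etaleToProetPullbackULift X).obj I ∈ etaleAcyclic X := by
  have hG : ∀ W ∈ {W : X.ProEt | isProetAffine X W}, ∀ n : ℕ,
      Subsingleton (Abelian.Ext.{uS + 1} (proetFreeZ X W) ((etaleToProetPullbackULift X).obj I) (n + 1)) := by
    intro W hW n
    exact subsingleton_ext_freeSheaf_of_cech_exactAt.{uS + 1, uS + 1} (J := Scheme.ProEt.topology X)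
      (fun W => isProetAffine X W)
      (fun W (𝒱 : PreZeroHypercover.{uS + 1} W) =>
        ∃ (𝔭 : ProetAffinePresentation X W) (c : PresentedCover 𝔭), 𝒱 = c.family)
      (by
        rintro W _ ⟨𝔭, c, rfl⟩ n kk
        exact c.isProetAffine_cechWidePullback n kk)
      (by
        rintro W _ ⟨𝔭, c, rfl⟩
        exact c.mem)
      (by
        intro W hW S hS
        obtain ⟨𝔭, c, hc⟩ := hT' W hW S hS
        exact ⟨c.family, ⟨𝔭, c, rfl⟩, fun a => hc a.down⟩)
      ((etaleToProetPullbackULift X).obj I)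
      (by
        rintro W _ ⟨𝔭, c, rfl⟩ n
        exact c.cechCochainComplex_exactAt_succ I n)
      hW n
  exact mem_liftable_of_mem
    ((isLiftingClass_extVanishing X {W : X.ProEt | isProetAffine X W}).anti
      etaleAffineObjects_subset_isProetAffine) hG

end Cofinal

end Literature.AlgebraicGeometry.Motives

end

namespace Literature.AlgebraicGeometry.Motives

universe uT

/-- **Bhatt–Scholze Cor. 5.1.6 from the cofinality of presented covers alone.** With (B) proved
(`subsingleton_sheafH_uliftEtSheaf_of_injective`) and (A) reduced to the cofinality statement
(`etaleToProetPullbackULift_mem_etaleAcyclic_of_cofinal`), the named fact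
`nonempty_addEquiv_sheafH_etaleToProetPullback` follows from: every pro-étale covering sieve of a
pro-étale affine contains the arrows of a presented cover (the consequence of Thm. 2.3.4 used in
the printed proof). [cite: BhattScholze2015, Cor. 5.1.6 and Thm. 2.3.4] -/
theorem nonempty_addEquiv_sheafH_etaleToProetPullback_of_cofinal
    (hT' : ∀ (X : Scheme.{uT}) (W : X.ProEt), isProetAffine X W → ∀ S ∈ Scheme.ProEt.topology X W,
      ∃ (𝔭 : ProetAffinePresentation X W) (c : PresentedCover 𝔭), ∀ a, S (c.hom a)) :
    nonempty_addEquiv_sheafH_etaleToProetPullback.{uT} :=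
  nonempty_addEquiv_sheafH_etaleToProetPullback_of_etaleAcyclic' fun X I hI => by
    haveI := hI
    exact etaleToProetPullbackULift_mem_etaleAcyclic_of_cofinal X (hT' X) I

/-- **Prop. 5.6.2 (`ellAdicCohomology_limOneSequence`) from the cofinality of presented covers
alone.** [cite: BhattScholze2015, Prop. 5.6.2, Cor. 5.1.6 and Thm. 2.3.4] -/
theorem ellAdicCohomology_limOneSequence_of_cofinal
    (hT' : ∀ (X : Scheme.{uT}) (W : X.ProEt), isProetAffine X W → ∀ S ∈ Scheme.ProEt.topology X W,
      ∃ (𝔭 : ProetAffinePresentation X W) (c : PresentedCover 𝔭), ∀ a, S (c.hom a)) :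
    ellAdicCohomology_limOneSequence.{uT} :=
  ellAdicCohomology_limOneSequence_of_etaleAcyclic' fun X I hI => by
    haveI := hI
    exact etaleToProetPullbackULift_mem_etaleAcyclic_of_cofinal X (hT' X) I

end Literature.AlgebraicGeometry.Motives
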